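import Summits.Langlands.Langlands.Theorems.SkinnerWilesDefectOneFiveIsogenyEllipticCurvesOrdinaryLine
import Summits.Langlands.Langlands.Theorems.SkinnerWilesDefectOneFiveIsogenyEllipticCurvesIrreducible
import HarnessLib

/-!
# The ordinary vector of `V_ℓ E` (Serre 1968, IV A.2.2, rational form)
(route `SkinnerWilesDefectOne`, item stmt-Langlands-12922 `FiveIsogenyEllipticCurves`, helper)

Rational repackaging of `…OrdinaryLine.sub_mem_ker_of_receptacle` for the local clause and the
irreducibility bridge: for a subgroup `I ≤ Γ_K` with receptacles and `τ₀ ∈ I` acting on `T_ℓ E`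
with determinant `u₀ ≢ 1 (mod ℓ)` and `ρ(τ₀) - 1` not surjective on `V = V_ℓ E`, there are
non-zero `f₀, v₁ ∈ V` with `ρ(τ₀) f₀ = u₀ f₀`, `ρ(τ₀) v₁ = v₁`,
`(ρ(τ₀) - 1)(ρ(τ₀) - u₀) = 0` on `V`, every `τ ∈ I` acts trivially on `V / ℚ_ℓ f₀`, and every
`γ ∈ Γ_K` normalising `I` at `τ₀` (`γ τ₀ γ⁻¹ ∈ I`) has `f₀` as an eigenvector
(`exists_ordinaryVector`).  Here `f₀` spans Serre's line `X ⊗ ℚ = V_ℓ(Ê)`: the local inertia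
group acts on it through `χ_ℓ` and trivially on the quotient, and the decomposition group
stabilises it.

References: J.-P. Serre, *Abelian ℓ-adic representations and elliptic curves* (1968), IV A.2.2.
-/

noncomputable section

-- `Summit.Langlands.Langlands.…`: summit = sub-problem name (D-0017 layout), as in every Theorems file here.
set_option linter.dupNamespace false

open Literature.NumberTheory.EllipticCurves
open WeierstrassCurve Field Module

namespace Summit.Langlands.Langlands.Theorems.FiveIsogenyEllipticCurves

variable {K : Type} [Field K] (W : WeierstrassCurve K) [W.IsElliptic] (ℓ : ℕ) [hℓ : Fact ℓ.Prime]

omit [W.IsElliptic] in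
/-- `V_ℓ(σ) (1 ⊗ x) = 1 ⊗ T_ℓ(σ) x`. [folklore] -/
theorem rationalGaloisRepTate_toRational (σ : absoluteGaloisGroup K) (x : W.tateModule ℓ) :
    W.rationalGaloisRepTate ℓ σ (TateModule.toRational ℓ x) =
      TateModule.toRational ℓ (W.galoisRepTate ℓ σ x) :=
  rationalTateRepresentation_toRational (absoluteGaloisGroup K) (geomPoints W) ℓ σ x

/-- A `ℤ_ℓ`-bilinear vanishing on `T` passes to `V = ℚ_ℓ ⊗ T`: if `A (B x) = 0` for all `x ∈ T`
then `(A ⊗ ℚ_ℓ) ((B ⊗ ℚ_ℓ) y) = 0` for all `y ∈ V`. [folklore] -/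
theorem baseChange_comp_eq_zero {T : Type*} [AddCommGroup T] [Module ℤ_[ℓ] T] (A B : T →ₗ[ℤ_[ℓ]] T)
    (h : ∀ x, A (B x) = 0) (y : TensorProduct ℤ_[ℓ] ℚ_[ℓ] T) :
    A.baseChange ℚ_[ℓ] (B.baseChange ℚ_[ℓ] y) = 0 := by
  have hAB : A ∘ₗ B = 0 := LinearMap.ext h
  have := LinearMap.congr_fun (congrArg (LinearMap.baseChange ℚ_[ℓ]) hAB) y
  rwa [LinearMap.baseChange_comp, LinearMap.baseChange_zero] at this

/-- **The ordinary vector** (Serre 1968, IV A.2.2, rational form).  Let `I ≤ Γ_K` admit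
receptacles (`…Receptacle.exists_receptacle`), and let `τ₀ ∈ I` act on `T_ℓ E` with determinant
`u₀ ≢ 1 (mod ℓ)` and with `ρ(τ₀) - 1` not surjective on `V_ℓ E`.  Then there are non-zero
`f₀, v₁ ∈ V_ℓ E` with: `ρ(τ₀) f₀ = u₀ f₀`, `ρ(τ₀) v₁ = v₁`, `(ρ(τ₀) - 1)(ρ(τ₀) - u₀) = 0` on
`V_ℓ E`, every `τ ∈ I` acts trivially on `V_ℓ E / ℚ_ℓ f₀`, and `ρ(γ) f₀ ∈ ℚ_ℓ f₀` whenever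
`γ τ₀ γ⁻¹ ∈ I`. [cite: SerreAbelianLadic1968, IV A.2.2] -/
theorem exists_ordinaryVector (hℓK : (ℓ : K) ≠ 0) {I : Subgroup (absoluteGaloisGroup K)}
    (hX : ∀ m : ℕ, ∃ X : AddSubgroup (geomPoints W), X ≤ geomTorsion W ((ℓ ^ m : ℕ) : ℤ) ∧
      Nat.card X ≤ ℓ ^ m ∧ ∀ τ ∈ I, ∀ P ∈ geomTorsion W ((ℓ ^ m : ℕ) : ℤ), τ • P - P ∈ X)
    {τ₀ : absoluteGaloisGroup K} (hτ₀ : τ₀ ∈ I) {u₀ : ℤ_[ℓ]}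
    (hdet : LinearMap.det (W.galoisRepTate ℓ τ₀) = u₀) (hu₀ : ¬ (ℓ : ℤ_[ℓ]) ∣ u₀ - 1)
    (hns : ¬ Function.Surjective
      (W.rationalGaloisRepTate ℓ τ₀ - 1 : Module.End ℚ_[ℓ] (W.rationalTateModule ℓ))) :
    ∃ f₀ v₁ : W.rationalTateModule ℓ, f₀ ≠ 0 ∧ v₁ ≠ 0 ∧
      W.rationalGaloisRepTate ℓ τ₀ f₀ = (u₀ : ℚ_[ℓ]) • f₀ ∧ W.rationalGaloisRepTate ℓ τ₀ v₁ = v₁ ∧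
      (W.rationalGaloisRepTate ℓ τ₀ - 1) * (W.rationalGaloisRepTate ℓ τ₀ - (u₀ : ℚ_[ℓ]) • 1) = 0 ∧
      (∀ τ ∈ I, ∀ y, ∃ c : ℚ_[ℓ], W.rationalGaloisRepTate ℓ τ y - y = c • f₀) ∧
      ∀ γ : absoluteGaloisGroup K, γ * τ₀ * γ⁻¹ ∈ I →
        ∃ θ : ℚ_[ℓ], W.rationalGaloisRepTate ℓ γ f₀ = θ • f₀ := by
  haveI := module_free_tateModule_holds W ℓ
  haveI := module_finite_tateModule_holds W ℓ
  haveI := module_finite_rationalTateModule_holds W ℓ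
  have h2 := finrank_tateModule_eq_two_holds W ℓ hℓK
  have h2V := finrank_rationalTateModule_eq_two_holds W ℓ hℓK
  set g : W.tateModule ℓ →ₗ[ℤ_[ℓ]] W.tateModule ℓ := W.galoisRepTate ℓ τ₀ with hg
  set ρ := W.rationalGaloisRepTate ℓ with hρ
  -- Cayley–Hamilton on `T` and the generator `z`
  have hdet1 : LinearMap.det (g - 1) = 0 := det_sub_one_eq_zero_of_not_surjective g hns
  obtain ⟨hC1, hC2⟩ := comp_sub_smul_eq_zero_of_det h2 g hdet hdet1
  obtain ⟨z, x', -, hzker, hzℓ⟩ := exists_generator_not_dvd W ℓ hℓK hdet hu₀ hC2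
  have hz0 : z ≠ 0 := fun h => hzℓ ⟨0, by rw [h, smul_zero]⟩
  -- `u₀ ≠ 1` in `ℚ_ℓ`
  have hu1 : (u₀ : ℚ_[ℓ]) ≠ 1 := by
    intro h
    apply hu₀
    have : u₀ = 1 := Subtype.ext (h.trans PadicInt.coe_one.symm)
    rw [this, sub_self]
    exact dvd_zero _
  -- the vectors
  set f₀ : W.rationalTateModule ℓ := TateModule.toRational ℓ z with hf₀
  have hf₀0 : f₀ ≠ 0 := fun h => hz0 (TateModule.toRational_injective (by rw [← hf₀, h, map_zero]))
  have hρf₀ : ρ τ₀ f₀ = (u₀ : ℚ_[ℓ]) • f₀ := by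
    have e : g z = u₀ • z := by
      have := hzker
      rw [LinearMap.sub_apply, LinearMap.smul_apply, Module.End.one_apply, sub_eq_zero] at this
      exact this
    rw [hf₀, hρ, rationalGaloisRepTate_toRational, ← hg, e, LinearMap.map_smul_of_tower]
    exact algebraMap_smul ℚ_[ℓ] u₀ (TateModule.toRational ℓ z)
  obtain ⟨v₁, hv₁, hv₁0⟩ : ∃ v₁ : W.rationalTateModule ℓ, ρ τ₀ v₁ = v₁ ∧ v₁ ≠ 0 := by
    have hninj : ¬ Function.Injective (ρ τ₀ - 1 : Module.End ℚ_[ℓ] (W.rationalTateModule ℓ)) :=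
      fun hinj => hns (LinearMap.surjective_of_injective hinj)
    obtain ⟨v₁, hv₁, hne⟩ : ∃ v₁, (ρ τ₀ - 1) v₁ = 0 ∧ v₁ ≠ 0 := by
      by_contra hall
      push Not at hall
      exact hninj (LinearMap.ker_eq_bot.mp (LinearMap.ker_eq_bot'.mpr hall))
    refine ⟨v₁, ?_, hne⟩
    rwa [LinearMap.sub_apply, Module.End.one_apply, sub_eq_zero] at hv₁
  -- base change of the two factors
  have hsmul : ∀ y : W.rationalTateModule ℓ, (u₀ : ℚ_[ℓ]) • y = u₀ • y := fun y =>
    algebraMap_smul ℚ_[ℓ] u₀ y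
  have e1 : (ρ τ₀ - 1 : Module.End ℚ_[ℓ] (W.rationalTateModule ℓ)) = (g - 1).baseChange ℚ_[ℓ] :=
    baseChange_sub_one g
  have e2 : ∀ y, (ρ τ₀ - (u₀ : ℚ_[ℓ]) • 1) y = ((g - u₀ • 1).baseChange ℚ_[ℓ]) y := by
    intro y
    rw [LinearMap.baseChange_sub, LinearMap.baseChange_smul, LinearMap.baseChange_one,
      LinearMap.sub_apply, LinearMap.sub_apply, LinearMap.smul_apply, LinearMap.smul_apply,
      Module.End.one_apply, Module.End.one_apply, hsmul]
    rfl
  -- Cayley–Hamilton on `V`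
  have hCV : ∀ y, (ρ τ₀ - 1) ((ρ τ₀ - (u₀ : ℚ_[ℓ]) • 1) y) = 0 := by
    intro y
    rw [e1, e2]
    exact baseChange_comp_eq_zero ℓ _ _ hC1 y
  have hCV' : (ρ τ₀ - 1) * (ρ τ₀ - (u₀ : ℚ_[ℓ]) • 1) = 0 := LinearMap.ext hCV
  -- the line `L_u = ker (ρ(τ₀) - u₀)` is `ℚ_ℓ f₀`
  have hline : ∀ y, ρ τ₀ y = (u₀ : ℚ_[ℓ]) • y → ∃ μ : ℚ_[ℓ], y = μ • f₀ := by
    intro y hy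
    have hx : ρ τ₀ v₁ ≠ (u₀ : ℚ_[ℓ]) • v₁ := by
      rw [hv₁]
      intro h
      apply hu1
      have := smul_left_injective ℚ_[ℓ] hv₁0 (h.symm.trans (one_smul ℚ_[ℓ] v₁).symm)
      exact this
    exact exists_smul_eq_of_apply_eq_smul h2V (ρ τ₀) hf₀0 hρf₀ hx hy
  -- every `τ ∈ I` acts trivially modulo `L_u`
  have hquotT : ∀ τ ∈ I, ∀ y, (ρ τ₀ - (u₀ : ℚ_[ℓ]) • 1) (ρ τ y - y) = 0 := by
    intro τ hτ y
    have e3 : ρ τ y - y = (W.galoisRepTate ℓ τ - 1).baseChange ℚ_[ℓ] y := by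
      rw [← baseChange_sub_one]; rfl
    rw [e2, e3]
    exact baseChange_comp_eq_zero ℓ _ _ (sub_mem_ker_of_receptacle W ℓ hℓK hX hτ₀ hdet hu₀ hns hτ) y
  have hquot : ∀ τ ∈ I, ∀ y, ∃ c : ℚ_[ℓ], ρ τ y - y = c • f₀ := by
    intro τ hτ y
    refine hline _ ?_
    have := hquotT τ hτ y
    rwa [LinearMap.sub_apply, LinearMap.smul_apply, Module.End.one_apply, sub_eq_zero] at this
  -- the normaliser stabilises the line
  have hnorm : ∀ γ : absoluteGaloisGroup K, γ * τ₀ * γ⁻¹ ∈ I →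
      ∃ θ : ℚ_[ℓ], ρ γ f₀ = θ • f₀ := by
    intro γ hγ
    refine hline _ ?_
    set y := ρ γ f₀ with hy
    have h1 : ρ (γ * τ₀ * γ⁻¹) y - y = ((u₀ : ℚ_[ℓ]) - 1) • y := by
      rw [hy, map_mul, map_mul, Module.End.mul_apply, Module.End.mul_apply, ← Module.End.mul_apply (ρ γ⁻¹),
        ← map_mul, inv_mul_cancel, map_one, Module.End.one_apply, hρf₀, map_smul, sub_smul, one_smul]
    have h2 := hquotT _ hγ y
    rw [h1, map_smul, smul_eq_zero] at h2
    rcases h2 with h | h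
    · exact absurd (sub_eq_zero.mp h) hu1
    · rwa [LinearMap.sub_apply, LinearMap.smul_apply, Module.End.one_apply, sub_eq_zero] at h
  exact ⟨f₀, v₁, hf₀0, hv₁0, hρf₀, hv₁, hCV', hquot, hnorm⟩

end Summit.Langlands.Langlands.Theorems.FiveIsogenyEllipticCurves

end
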